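import Literature.MathematicalPhysics.QuantumManyBody.GroundState
import Summits.AtomisticToContinuum.BoseEinsteinCondensation.Theorems.BECCutLineWeakDisorderGroundStateRigidityStubUniqueOfPos
import HarnessLib

/-!
# Crux `GroundStateRigidity` (stmt-AtomisticToContinuum-9072), line `Sketch`:
# the registered stub `stub_uniqueOfPosOn`

Supports (does not close) stmt-AtomisticToContinuum-9072; stub `stub_uniqueOfPosOn` of line Sketch
(Stub 20, lead c3). **Uniqueness of the closed-form ground state up to a constant phase from a.e.
positivity of nonnegative ground states on a measurable carrier `S`** (the lattice/sign argument
of Reed–Simon IV §XIII.12, Thm XIII.44, run on the cone of closed-form minimisers of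
`GroundState.lean`). This is the landed `stub_uniqueOfPos` with the box `Λ_L^N` replaced by a
carrier `S ⊆ (ℝ³)^N`; what the box gave for free (`IsGroundState.eq_zero`: a ground state
vanishes off the box) is now the hypothesis `hvan`: EVERY ground state vanishes a.e. off `S`.
Inputs, all as hypotheses: (i) `hlin` — a normalised linear combination of two ground states is
a ground state (the registered statement of `stub_lincombGroundState`); (ii) `hvan`;
(iii) `hpos` — every nonnegative real ground state is a.e. strictly positive on `S`.

Proof (as in the template, whose carrier-free lemmas are reused). (1) The modulus `|Θ|` of a
ground state is a ground state (`UniqueOfPos.isGroundState_modulus`). (2) Sign lemma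
(`pos_or_neg_on`): a REAL ground state `g` is a.e. `> 0` on `S` or a.e. `< 0` on `S` —
`g⁺ = (|g| + g)/2`, unless a.e. zero, is after normalisation a nonnegative ground state (`hlin`
with `|g|`, `g`), so `g > 0` a.e. on `S` by `hpos`; otherwise `g ≤ 0` a.e. and the same for `−g`.
(3) Two nonnegative ground states `P, Q` agree a.e. (`ae_eq_of_nonneg_on`): else
`(P − Q)/‖P − Q‖₂` is a real ground state (`hlin`) of strict sign a.e. on `S`, while `P = Q = 0`
a.e. off `S` (`hvan`) and `S` has positive measure (a ground state lives on it), contradicting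
`∫ P² = ∫ Q² = 1` (`not_lt_of_nonneg_on`). (4) For a ground state `Θ` and the nonnegative one
`Ψ₀`: `|Θ| = Ψ₀` a.e., and for `u ∈ {1, i}` the modulus of the normalised `Θ + u Ψ₀` is again
`Ψ₀` a.e., i.e. `|Θ + u Ψ₀| = r_u Ψ₀`; so wherever `Ψ₀ > 0` the quotient `Θ/Ψ₀` has modulus `1`,
real part `(r₁² − 2)/2` and imaginary part `(r_i² − 2)/2`: `Θ = c Ψ₀` a.e. with `|c| = 1`
(`exists_ae_eq_const_mul_on`). Two ground states `c₁ Ψ₀`, `c₂ Ψ₀` then differ by the phase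
`c₂ conj c₁`. Measurability of `S` is not needed.
-/

noncomputable section

open MeasureTheory Filter
open scoped ENNReal NNReal Topology ComplexConjugate

namespace Summit.AtomisticToContinuum.BoseEinsteinCondensation.Theorems.GroundStateRigidity

open Literature.MathematicalPhysics.QuantumManyBody.BoseGas

namespace UniqueOfPosOn

open UniqueOfPos

variable {N : ℕ} {v : ℝ → ℝ≥0∞} {L : ℝ} {S : Set (Config N)}

/-- If a ground state vanishes a.e. off a carrier `S`, then `S` has positive measure (a ground
state is not a.e. zero). [folklore] -/
theorem volume_ne_zero {Θ : Config N → ℂ} (hΘ : IsGroundState v L Θ)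
    (hΘS : ∀ᵐ X : Config N, X ∉ S → Θ X = 0) : volume S ≠ 0 := fun h0 =>
  not_ae_eq_zero hΘ (((measure_eq_zero_iff_ae_notMem.1 h0).and hΘS).mono fun _ hX => hX.2 hX.1)

/-- Two nonnegative ground states vanishing a.e. off the carrier `S` cannot be strictly ordered
a.e. on `S`: both have `∫ |·|² = 1` and `S` has positive measure. [folklore] -/
theorem not_lt_of_nonneg_on {P Q : Config N → ℝ} (hQ0 : ∀ X, 0 ≤ Q X)
    (hP : IsGroundState v L (fun X => (P X : ℂ))) (hQ : IsGroundState v L (fun X => (Q X : ℂ)))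
    (hPS : ∀ᵐ X : Config N, X ∉ S → (P X : ℂ) = 0)
    (hQS : ∀ᵐ X : Config N, X ∉ S → (Q X : ℂ) = 0)
    (hlt : ∀ᵐ X : Config N, X ∈ S → Q X < P X) : False := by
  have hle : (fun X => (‖(Q X : ℂ)‖₊ : ℝ≥0∞) ^ 2) ≤ᵐ[volume]
      fun X => (‖(P X : ℂ)‖₊ : ℝ≥0∞) ^ 2 := by
    filter_upwards [hlt, hPS, hQS] with X hX hPX hQX
    show (‖(Q X : ℂ)‖₊ : ℝ≥0∞) ^ 2 ≤ (‖(P X : ℂ)‖₊ : ℝ≥0∞) ^ 2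
    by_cases hmem : X ∈ S
    · rw [ExistsNonneg.coe_nnnorm_ofReal_sq, ExistsNonneg.coe_nnnorm_ofReal_sq]
      exact ENNReal.ofReal_le_ofReal (pow_le_pow_left₀ (hQ0 X) (hX hmem).le 2)
    · rw [hQX hmem, hPX hmem]
  have hlt' : ∀ᵐ X : Config N, X ∈ S →
      (‖(Q X : ℂ)‖₊ : ℝ≥0∞) ^ 2 < (‖(P X : ℂ)‖₊ : ℝ≥0∞) ^ 2 := by
    filter_upwards [hlt] with X hX hmem
    have h := hX hmem
    have hP0 : 0 < P X := (hQ0 X).trans_lt h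
    rw [ExistsNonneg.coe_nnnorm_ofReal_sq, ExistsNonneg.coe_nnnorm_ofReal_sq]
    exact (ENNReal.ofReal_lt_ofReal_iff (pow_pos hP0 2)).2
      (pow_lt_pow_left₀ h (hQ0 X) two_ne_zero)
  have h := lintegral_strict_mono_of_ae_le_of_ae_lt_on
    ((hP.measurable.nnnorm.coe_nnreal_ennreal).pow_const 2).aemeasurable
    (by rw [hQ.norm_eq]; exact ENNReal.one_ne_top) hle (volume_ne_zero hP hPS) hlt'
  rw [hQ.norm_eq, hP.norm_eq] at h
  exact lt_irrefl _ h

/-! ### Consequences of `hlin`, `hpos` (and `hvan`, kept explicit) -/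

section Lincomb

variable
  (hlin : ∀ (N : ℕ) (v : ℝ → ℝ≥0∞) (L : ℝ) (Ψ Φ : Config N → ℂ) (a b : ℂ),
    IsGroundState v L Ψ → IsGroundState v L Φ →
    ∫⁻ X, (‖a * Ψ X + b * Φ X‖₊ : ℝ≥0∞) ^ 2 = 1 →
    IsGroundState v L (fun X => a * Ψ X + b * Φ X))
  (hpos : ∀ Ψ₀ : Config N → ℝ, (∀ X, 0 ≤ Ψ₀ X) → IsGroundState v L (fun X => (Ψ₀ X : ℂ)) →
    ∀ᵐ X : Config N, X ∈ S → 0 < Ψ₀ X)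

include hlin hpos

/-- Half of the sign lemma on a carrier: a real ground state `g` is a.e. positive on `S` or a.e.
nonpositive. `g⁺ = (|g| + g)/2`, if not a.e. zero, is after normalisation a nonnegative ground
state (`hlin` applied to the ground states `|g|` and `g`), hence a.e. positive on `S` (`hpos`),
and `|g| + g > 0 ↔ g > 0`. [cite: ReedSimonIV1978, §XIII.12 Thm XIII.44] -/
theorem pos_or_nonpos_on {g : Config N → ℝ} (hG : IsGroundState v L (fun X => (g X : ℂ))) :
    (∀ᵐ X : Config N, X ∈ S → 0 < g X) ∨ (∀ᵐ X : Config N, g X ≤ 0) := by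
  have hA := isGroundState_modulus hG
  have hFm : Measurable fun X => ((‖(g X : ℂ)‖ : ℝ) : ℂ) + (g X : ℂ) :=
    hA.measurable.add hG.measurable
  set m : ℝ≥0∞ := ∫⁻ X, (‖((‖(g X : ℂ)‖ : ℝ) : ℂ) + (g X : ℂ)‖₊ : ℝ≥0∞) ^ 2 with hm_def
  by_cases hm : m = 0
  · right
    filter_upwards [ae_eq_zero_of_lintegral_eq_zero hFm hm] with X hX
    rw [Complex.norm_real, Real.norm_eq_abs, ← Complex.ofReal_add, Complex.ofReal_eq_zero] at hX
    linarith [abs_nonneg (g X)]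
  · left
    have hmt : m ≠ ⊤ := lintegral_nnnorm_add_sq_ne_top hG.measurable hA.norm_eq hG.norm_eq
    obtain ⟨s, hs0, h1⟩ := exists_normalise hm hmt
    simp_rw [mul_add] at h1
    have hgs := hlin N v L _ _ (s : ℂ) (s : ℂ) hA hG h1
    have hgs' : IsGroundState v L (fun X => ((s * (|g X| + g X) : ℝ) : ℂ)) :=
      isGroundState_congr hgs fun X => by
        simp only [Complex.norm_real, Real.norm_eq_abs]
        push_cast
        ring
    have hP : ∀ᵐ X : Config N, X ∈ S → 0 < s * (|g X| + g X) :=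
      hpos (fun X => s * (|g X| + g X))
        (fun X => mul_nonneg hs0.le (by linarith [neg_abs_le (g X)])) hgs'
    filter_upwards [hP] with X hX hmem
    have h2 : 0 < |g X| + g X := pos_of_mul_pos_right (hX hmem) hs0.le
    by_contra h3
    rw [abs_of_nonpos (le_of_not_gt h3)] at h2
    linarith

/-- **Sign lemma on a carrier**: a real ground state is a.e. strictly positive on `S` or a.e.
strictly negative on `S` (`pos_or_nonpos_on` for `g` and `−g`; `g ≤ 0 ∧ g ≥ 0` a.e. would make
the normalised `g` vanish a.e.). [cite: ReedSimonIV1978, §XIII.12 Thm XIII.44] -/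
theorem pos_or_neg_on {g : Config N → ℝ} (hG : IsGroundState v L (fun X => (g X : ℂ))) :
    (∀ᵐ X : Config N, X ∈ S → 0 < g X) ∨ (∀ᵐ X : Config N, X ∈ S → g X < 0) := by
  rcases pos_or_nonpos_on hlin hpos hG with h | h
  · exact Or.inl h
  have hG' : IsGroundState v L (fun X => ((-g X : ℝ) : ℂ)) :=
    isGroundState_congr (hG.const_mul (c := -1) (by simp)) fun X => by push_cast; ring
  rcases pos_or_nonpos_on hlin hpos hG' with h' | h'
  · exact Or.inr (h'.mono fun X hX hmem => by linarith [hX hmem])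
  · exfalso
    refine not_ae_eq_zero hG ?_
    filter_upwards [h, h'] with X h1 h2
    have h0 : g X = 0 := le_antisymm h1 (by linarith)
    simp [h0]

/-- **Two nonnegative ground states agree a.e.** (carrier version): otherwise `(P − Q)/‖P − Q‖₂`
is a real ground state (`hlin`), hence of strict sign a.e. on `S` (`pos_or_neg_on`), while
`P = Q = 0` a.e. off `S` (`hvan`), contradicting `∫ P² = ∫ Q² = 1` (`not_lt_of_nonneg_on`).
[cite: ReedSimonIV1978, §XIII.12 Thm XIII.44] -/
theorem ae_eq_of_nonneg_on
    (hvan : ∀ Ψ : Config N → ℂ, IsGroundState v L Ψ → ∀ᵐ X : Config N, X ∉ S → Ψ X = 0)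
    {P Q : Config N → ℝ} (hP0 : ∀ X, 0 ≤ P X) (hQ0 : ∀ X, 0 ≤ Q X)
    (hP : IsGroundState v L (fun X => (P X : ℂ))) (hQ : IsGroundState v L (fun X => (Q X : ℂ))) :
    ∀ᵐ X : Config N, P X = Q X := by
  by_contra hne
  have hQ' := hQ.const_mul (c := (-1 : ℂ)) (by simp)
  have hFm : Measurable fun X => (P X : ℂ) + (-1) * (Q X : ℂ) := hP.measurable.add hQ'.measurable
  set m : ℝ≥0∞ := ∫⁻ X, (‖(P X : ℂ) + (-1) * (Q X : ℂ)‖₊ : ℝ≥0∞) ^ 2 with hm_def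
  have hm : m ≠ 0 := by
    intro h0
    apply hne
    filter_upwards [ae_eq_zero_of_lintegral_eq_zero hFm h0] with X hX
    have h1 : ((P X - Q X : ℝ) : ℂ) = 0 := by rw [← hX]; push_cast; ring
    exact sub_eq_zero.1 (Complex.ofReal_eq_zero.1 h1)
  have hmt : m ≠ ⊤ := lintegral_nnnorm_add_sq_ne_top hQ'.measurable hP.norm_eq hQ'.norm_eq
  obtain ⟨s, hs0, h1⟩ := exists_normalise hm hmt
  simp_rw [mul_add] at h1
  have hgs := hlin N v L _ _ (s : ℂ) (s : ℂ) hP hQ' h1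
  have hgs' : IsGroundState v L (fun X => ((s * (P X - Q X) : ℝ) : ℂ)) :=
    isGroundState_congr hgs fun X => by push_cast; ring
  rcases pos_or_neg_on hlin hpos hgs' with h | h
  · refine not_lt_of_nonneg_on hQ0 hP hQ (hvan _ hP) (hvan _ hQ) (h.mono fun X hX hmem => ?_)
    have h2 : 0 < P X - Q X := pos_of_mul_pos_right (hX hmem) hs0.le
    linarith
  · refine not_lt_of_nonneg_on hP0 hQ hP (hvan _ hQ) (hvan _ hP) (h.mono fun X hX hmem => ?_)
    have h2 : s * (P X - Q X) < 0 := hX hmem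
    nlinarith [h2, hs0]

/-- For a ground state `Θ`, a nonnegative ground state `Ψ₀` and a unit `u` (carrier version):
`|Θ + u Ψ₀| = r Ψ₀` a.e. for some real `r` — if `Θ + u Ψ₀` is not a.e. zero, its normalisation
`s (Θ + u Ψ₀)` is a ground state (`hlin`), whose modulus is a nonnegative ground state
(`isGroundState_modulus`), a.e. equal to `Ψ₀` (`ae_eq_of_nonneg_on`); `r = 1/s`. [folklore] -/
theorem exists_norm_add_eq_on
    (hvan : ∀ Ψ : Config N → ℂ, IsGroundState v L Ψ → ∀ᵐ X : Config N, X ∉ S → Ψ X = 0)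
    {Ψ₀ : Config N → ℝ} (hΨ₀0 : ∀ X, 0 ≤ Ψ₀ X)
    (hΨ₀ : IsGroundState v L (fun X => (Ψ₀ X : ℂ))) {Θ : Config N → ℂ}
    (hΘ : IsGroundState v L Θ) {u : ℂ} (hu : ‖u‖ = 1) :
    ∃ r : ℝ, ∀ᵐ X : Config N, ‖Θ X + u * Ψ₀ X‖ = r * Ψ₀ X := by
  have hU := hΨ₀.const_mul hu
  have hFm : Measurable fun X => Θ X + u * (Ψ₀ X : ℂ) := hΘ.measurable.add hU.measurable
  set m : ℝ≥0∞ := ∫⁻ X, (‖Θ X + u * (Ψ₀ X : ℂ)‖₊ : ℝ≥0∞) ^ 2 with hm_def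
  by_cases hm : m = 0
  · refine ⟨0, ?_⟩
    filter_upwards [ae_eq_zero_of_lintegral_eq_zero hFm hm] with X hX
    rw [hX, norm_zero, zero_mul]
  have hmt : m ≠ ⊤ := lintegral_nnnorm_add_sq_ne_top hU.measurable hΘ.norm_eq hU.norm_eq
  obtain ⟨s, hs0, h1⟩ := exists_normalise hm hmt
  simp_rw [mul_add] at h1
  have hgs := hlin N v L _ _ (s : ℂ) (s : ℂ) hΘ hU h1
  have hmod := isGroundState_modulus hgs
  have hae : ∀ᵐ X : Config N, ‖(s : ℂ) * Θ X + (s : ℂ) * (u * (Ψ₀ X : ℂ))‖ = Ψ₀ X :=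
    ae_eq_of_nonneg_on hlin hpos hvan
      (P := fun X => ‖(s : ℂ) * Θ X + (s : ℂ) * (u * (Ψ₀ X : ℂ))‖) (fun X => norm_nonneg _)
      hΨ₀0 hmod hΨ₀
  refine ⟨s⁻¹, ?_⟩
  filter_upwards [hae] with X hX
  rw [← mul_add, norm_mul, Complex.norm_real, Real.norm_of_nonneg hs0.le] at hX
  rw [eq_inv_mul_iff_mul_eq₀ hs0.ne']
  exact hX

/-- **Every ground state is a constant phase times the nonnegative one** (carrier version). With
`|Θ| = Ψ₀`, `|Θ + Ψ₀| = r₁ Ψ₀` and `|Θ + i Ψ₀| = r₂ Ψ₀` a.e. (`ae_eq_of_nonneg_on`,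
`exists_norm_add_eq_on`), the quotient `Θ/Ψ₀` has modulus `1`, real part `(r₁² − 2)/2` and
imaginary part `(r₂² − 2)/2` wherever `Ψ₀ > 0`; so `Θ = c Ψ₀` a.e., and `|c| = 1` because `Ψ₀`
is not a.e. zero. [cite: ReedSimonIV1978, §XIII.12 Thm XIII.44] -/
theorem exists_ae_eq_const_mul_on
    (hvan : ∀ Ψ : Config N → ℂ, IsGroundState v L Ψ → ∀ᵐ X : Config N, X ∉ S → Ψ X = 0)
    {Ψ₀ : Config N → ℝ} (hΨ₀0 : ∀ X, 0 ≤ Ψ₀ X)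
    (hΨ₀ : IsGroundState v L (fun X => (Ψ₀ X : ℂ))) {Θ : Config N → ℂ}
    (hΘ : IsGroundState v L Θ) :
    ∃ c : ℂ, ‖c‖ = 1 ∧ ∀ᵐ X : Config N, Θ X = c * Ψ₀ X := by
  have h0 : ∀ᵐ X : Config N, ‖Θ X‖ = Ψ₀ X :=
    ae_eq_of_nonneg_on hlin hpos hvan (P := fun X => ‖Θ X‖) (fun X => norm_nonneg _) hΨ₀0
      (isGroundState_modulus hΘ) hΨ₀
  obtain ⟨r₁, h1⟩ := exists_norm_add_eq_on hlin hpos hvan hΨ₀0 hΨ₀ hΘ (u := 1) (by simp)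
  obtain ⟨r₂, h2⟩ :=
    exists_norm_add_eq_on hlin hpos hvan hΨ₀0 hΨ₀ hΘ (u := Complex.I) (by simp)
  set c : ℂ := (((r₁ ^ 2 - 2) / 2 : ℝ) : ℂ) + (((r₂ ^ 2 - 2) / 2 : ℝ) : ℂ) * Complex.I
    with hc_def
  have hae : ∀ᵐ X : Config N, Θ X = c * Ψ₀ X := by
    filter_upwards [h0, h1, h2] with X e0 e1 e2
    rcases (hΨ₀0 X).eq_or_lt with hp | hp
    · have hz : Θ X = 0 := norm_eq_zero.1 (e0.trans hp.symm)
      rw [hz, ← hp]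
      simp
    · have n0 : ‖Θ X‖ ^ 2 = (Θ X).re ^ 2 + (Θ X).im ^ 2 := by
        rw [Complex.sq_norm, Complex.normSq_apply]; ring
      have n1 : ‖Θ X + 1 * (Ψ₀ X : ℂ)‖ ^ 2 = ((Θ X).re + Ψ₀ X) ^ 2 + (Θ X).im ^ 2 := by
        rw [Complex.sq_norm, Complex.normSq_apply]
        simp only [Complex.add_re, Complex.add_im, Complex.mul_re, Complex.mul_im,
          Complex.one_re, Complex.one_im, Complex.ofReal_re, Complex.ofReal_im]
        ring
      have n2 : ‖Θ X + Complex.I * (Ψ₀ X : ℂ)‖ ^ 2 = (Θ X).re ^ 2 + ((Θ X).im + Ψ₀ X) ^ 2 := by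
        rw [Complex.sq_norm, Complex.normSq_apply]
        simp only [Complex.add_re, Complex.add_im, Complex.mul_re, Complex.mul_im,
          Complex.I_re, Complex.I_im, Complex.ofReal_re, Complex.ofReal_im]
        ring
      rw [e0] at n0
      rw [e1] at n1
      rw [e2] at n2
      have h2p : (2 * Ψ₀ X) ≠ 0 := mul_ne_zero two_ne_zero hp.ne'
      have hre : (Θ X).re = (r₁ ^ 2 - 2) / 2 * Ψ₀ X := by
        refine mul_left_cancel₀ h2p ?_
        linear_combination n0 - n1
      have him : (Θ X).im = (r₂ ^ 2 - 2) / 2 * Ψ₀ X := by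
        refine mul_left_cancel₀ h2p ?_
        linear_combination n0 - n2
      apply Complex.ext
      · simp only [hc_def, Complex.add_re, Complex.mul_re, Complex.ofReal_re, Complex.ofReal_im,
          Complex.I_re, Complex.I_im]
        rw [hre]
        ring
      · simp only [hc_def, Complex.add_im, Complex.mul_re, Complex.mul_im, Complex.ofReal_re,
          Complex.ofReal_im, Complex.I_re, Complex.I_im, Complex.add_re]
        rw [him]
        ring
  refine ⟨c, ?_, hae⟩
  by_contra hc
  refine not_ae_eq_zero hΨ₀ ?_
  filter_upwards [h0, hae] with X e0 e1
  by_contra hne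
  have hp : Ψ₀ X ≠ 0 := fun h => hne (by simp [h])
  apply hc
  rw [e1, norm_mul, Complex.norm_real, Real.norm_of_nonneg (hΨ₀0 X)] at e0
  exact (mul_eq_right₀ hp).1 e0

end Lincomb

end UniqueOfPosOn

/-! ### The stub -/

open UniqueOfPosOn in
/-- **Stub `stub_uniqueOfPosOn` of line `Sketch` (Stub 20) — uniqueness up to phase from a.e.
positivity of nonnegative ground states on a carrier (every `v`).** As the landed
`stub_uniqueOfPos`, with the box replaced by a measurable carrier `S` off which every ground
state vanishes a.e.: given, as hypotheses, that normalised linear combinations of ground states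
are ground states (the registered statement of `stub_lincombGroundState`), that a nonnegative
ground state exists, that every ground state vanishes a.e. off `S`, and that EVERY nonnegative
ground state is a.e. strictly positive on `S`, we get `HasUniqueGroundState v N L`: by the
lattice/sign argument on the cone of minimisers (`|Θ|` is a ground state; real ground states have
a strict sign a.e. on `S` and vanish a.e. off `S`; two nonnegative ground states agree a.e.)
every ground state is `c Ψ₀` a.e. with `|c| = 1` (`UniqueOfPosOn.exists_ae_eq_const_mul_on`), so
two ground states `c₁ Ψ₀`, `c₂ Ψ₀` differ by the constant phase `c₂ conj c₁`. (Measurability of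
`S` is not used.) [cite: ReedSimonIV1978, §XIII.12 Thm XIII.44] -/
theorem stub_uniqueOfPosOn :
    (∀ (N : ℕ) (v : ℝ → ℝ≥0∞) (L : ℝ) (Ψ Φ : Config N → ℂ) (a b : ℂ),
      IsGroundState v L Ψ → IsGroundState v L Φ →
      ∫⁻ X, (‖a * Ψ X + b * Φ X‖₊ : ℝ≥0∞) ^ 2 = 1 →
      IsGroundState v L (fun X => a * Ψ X + b * Φ X)) →
    ∀ (N : ℕ) (v : ℝ → ℝ≥0∞) (L : ℝ) (S : Set (Config N)), MeasurableSet S →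
      (∃ Ψ₀ : Config N → ℝ, (∀ X, 0 ≤ Ψ₀ X) ∧ IsGroundState v L (fun X => (Ψ₀ X : ℂ))) →
      (∀ Ψ : Config N → ℂ, IsGroundState v L Ψ → ∀ᵐ X : Config N, X ∉ S → Ψ X = 0) →
      (∀ Ψ₀ : Config N → ℝ, (∀ X, 0 ≤ Ψ₀ X) → IsGroundState v L (fun X => (Ψ₀ X : ℂ)) →
        ∀ᵐ X : Config N, X ∈ S → 0 < Ψ₀ X) →
      HasUniqueGroundState v N L := by
  intro hlin N v L S _ hex hvan hpos
  refine ⟨hex, fun Ψ Φ hΨ hΦ => ?_⟩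
  obtain ⟨Ψ₀, hΨ₀0, hΨ₀⟩ := hex
  obtain ⟨c₁, hc₁, h₁⟩ := exists_ae_eq_const_mul_on hlin hpos hvan hΨ₀0 hΨ₀ hΨ
  obtain ⟨c₂, hc₂, h₂⟩ := exists_ae_eq_const_mul_on hlin hpos hvan hΨ₀0 hΨ₀ hΦ
  refine ⟨c₂ * conj c₁, by rw [norm_mul, Complex.norm_conj, hc₁, hc₂, mul_one], ?_⟩
  filter_upwards [h₁, h₂] with X e₁ e₂
  rw [e₂, e₁, mul_assoc, ← mul_assoc (conj c₁), Complex.conj_mul', hc₁]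
  simp

end Summit.AtomisticToContinuum.BoseEinsteinCondensation.Theorems.GroundStateRigidity

end
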